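import Summits.QuantumFields.BalabanUV.T4Continuum.Support.NE3HessBounds
import Summits.QuantumFields.BalabanUV.T4Continuum.Support.NE3EnergySource
import Summits.QuantumFields.BalabanUV.T4Continuum.Support.AveragingDeficitPlaqDeriv
import Literature.MathematicalPhysics.QuantumFieldTheory.Balaban1983to89.T4ConvexResponse
import HarnessLib

/-!
# T⁴ programme, node NE3 — readings (D)∕(F), row S6-Z2 (P3 leaf L12 «READ-OUTS»), file 1: THE LOCAL ACTION READ-OUT —
# the Wilson action of a plaquette WINDOW along the unit segment `V ↦ V·e^{X}` is controlled by the window's own data: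
# `|A_W(V e^X) − A_W(V)| ≤ a·Σ_{p∈W}‖(d_V X)(p)‖ + (7/2)·Σ_{p∈W} Σ_{b⊂∂p}‖X(b)‖²`

NE3 formalisation swarm `b2b-balaban-t4-ne3-formalise-*` of the cell `pub-balaban`, unit `b2b-balaban-t4-ne3-formalise-leaf-01`
(gen 2), row **S6-Z2** of `t4/formal/NE3/LEAVES.md` v1.7 ρ13 (= road P3's leaf L12 of `t4/skeletons/NE3-t4-ne3-p3.md` §2:
«(D) |e_{k+1}(V)(x) − e_k(V)(x)| ≤ |𝓓_{W(B(x))}(U_B)| + |A_{B(x)}(W) − A_{B(x)}(U_A)| ≤ [β′-loc] + [C·(plaquette radius)·Σ_p‖(d_{U_A}X)(p)‖ +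
C·Σ‖X‖²]»).  THIS FILE supplies the SECOND bracket as a kernel lemma about ONE pair of configurations on ONE window
([folklore]; 0 defs, 0 sorry):

* `abs_hessPlaqAt_self_le` — for unitary `V` and any direction `X`: `|hessPlaqAt V X X p′| ≤ 7·bondSqAt X p′`
  (`‖dcurl‖ ≤ 3·bondSq`, `‖curl‖² ≤ 4·bondSq` from `NE3HessBounds`, `‖V(∂p′)‖ = 1`);
* `abs_hess_self_le`, `abs_hess_vary_self_le` — `|hess V X X W| ≤ 7·Σ_{p∈W} bondSq X p`, uniformly along `V·e^{tX}`
  (skew `X`: the varied configuration stays unitary; `bondSq` does not see the configuration);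
* **`abs_fineAction_vary_sub_sub_dAction_le`** — second-order Taylor along the segment (the tree's `taylor_lower` applied to
  `±` the action): `|A_W(V e^X) − A_W(V) − dAction V X W| ≤ (7/2)·Σ_{p∈W} bondSq X p`;
* **`abs_fineAction_vary_sub_le`** — THE (D) READ-OUT BRACKET: if the plaquette variables of `V` on `W` are within `a` of `1`
  then `|A_W(V e^X) − A_W(V)| ≤ a·Σ_{p∈W}‖(d_V X)(p)‖ + (7/2)·Σ_{p∈W} bondSq X p` — the linear term carries the plaquette
  RADIUS because `Re tr` of a skew insertion against a flat plaquette vanishes (`NE3EnergySource.abs_sum_nReTr_curl_fhol_le`);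
  `abs_fineAction_vary_sub_le_of_smallField` is the same under `SmallField V a`.

What is NOT here: the local deficit bracket (β′-loc, `T4AveragingDeficitNonAbelian.abs_deficit_blockWindow_le`, KERNEL, imported
BY NAME by the assembly), the LOCAL ENERGY RATE T-LOC-P3 that makes the right-hand side `O(ε²(L⁻¹)^k)` (hypothesis structures
of road P3 — `TangentCoercive`, `RelLandauRep`, …), and the packaging into `T4EtaRateMin.LocalRate` (assembly Z0
`Spine/NE3SegmentRoute`, NOT a crew row).

HONEST FRAMING.  Elementary calculus and norm bookkeeping for fixed configurations on a finite window; no minimiser, no two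
lattice spacings; nothing printed is a hypothesis; nothing restated (all inputs BY NAME); no `def`, no `def … : Prop` fact,
no `sorry`; axioms ⊆ {propext, Classical.choice, Quot.sound}; `BetaPertH`, (B), G-an2-4 occur nowhere.  **NE3 is NOT
proved**; the LOCAL half `LocalRate` of `T4EtaRateMin.NE3Shape` stays CONDITIONAL on T-LOC-P3.  Finite T⁴ rung (B)+1 — NOT
infinite volume, NOT a mass gap, NOT the Clay problem, NOT summit progress; spine estimates PROVED 0∕9.
HONEST DEPENDENCY (cell page 1): continuum YM on T⁴ ⇐ BetaPertH ∧ nine spine estimates (0/9 proved); BetaPertH ⇐ (D1) ∧ (D4) ∧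
CAP+tail; G-an2-4 gates asym, D1 and NE2/3/4.  PLACEMENT (human rule 2026-08-19): under `Summits/QuantumFields/BalabanUV/`.
Context only: T. Bałaban, Commun. Math. Phys. **102** (1985) 277–309 [Balaban1985Variational] (26)–(28) p. 282.
-/

set_option autoImplicit false

open scoped BigOperators Matrix Matrix.Norms.L2Operator
open NormedSpace Set

namespace Summit.QuantumFields.BalabanUV.T4Continuum.NE3LocalReadouts

open Literature.MathematicalPhysics.QuantumFieldTheory.Balaban1983to89
open B7Prop1Explicit B7Prop2Explicit MatrixLog UnitaryModel MatrixNorms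
open T4AveragingDeficitWall hiding Site Plane Plaq Bond
open T4ConvexResponse (taylor_lower)
open AveragingDeficitNearIdentity (abs_nReTr_mul_le)
open AveragingDeficitPlaqDeriv (vary_isUnitaryCfg)
open NE3HessForm NE3HessBounds
open NE3EnergySource (abs_sum_nReTr_curl_fhol_le fhol_sub_one_le_of_smallField)

noncomputable section

variable {d : ℕ} {n : Type*} [Fintype n] [DecidableEq n] [Nonempty n]

/-! ## §1 The Hessian density and form along a direction are bounded by the four-bond square sums -/

/-- **`|hessPlaqAt V X X p′| ≤ 7·bondSqAt X p′`** for unitary `V` and ANY direction `X`: the density is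
`−Re tr[(dcurl + curl²)·V(∂p′)]` with `‖dcurl‖ ≤ 3·bondSq`, `‖curl‖² ≤ 4·bondSq`, `‖V(∂p′)‖ = 1`. [folklore] -/
theorem abs_hessPlaqAt_self_le {V : Site d → Fin d → (Matrix n n ℂ)ˣ} (hV : IsUnitaryCfg V)
    (X : Site d → Fin d → Matrix n n ℂ) (z : Site d) (μ ν : Fin d) :
    |hessPlaqAt V X X z μ ν| ≤ 7 * bondSqAt X z μ ν := by
  unfold hessPlaqAt
  set D := dcurlAt V X X z μ ν
  set C := curlAt V X z μ ν
  set H := ((hol V z (plaqWord μ ν) : (Matrix n n ℂ)ˣ) : Matrix n n ℂ)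
  have hHu : hol V z (plaqWord μ ν) ∈ unitaryUnits (Matrix n n ℂ) := hol_mem_of hV z (plaqWord μ ν)
  have hH1 : ‖H‖ = 1 := CStarRing.norm_of_mem_unitary (mem_unitaryUnits.mp hHu)
  have h1 : |nReTr ((D + C * C) * H)| ≤ ‖D + C * C‖ * ‖H‖ := abs_nReTr_mul_le _ _
  have h2 : ‖D + C * C‖ ≤ 3 * bondSqAt X z μ ν + 4 * bondSqAt X z μ ν := by
    refine (norm_add_le _ _).trans (add_le_add (norm_dcurlAt_self_le hV X z μ ν) ?_)
    calc ‖C * C‖ ≤ ‖C‖ * ‖C‖ := opNorm_mul_le _ _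
      _ = ‖C‖ ^ 2 := by ring
      _ ≤ 4 * bondSqAt X z μ ν := norm_curlAt_sq_le hV X z μ ν
  rw [abs_neg, hH1, mul_one] at *
  linarith

/-- **`|hess V X X W| ≤ 7·Σ_{p∈W} bondSq X p`** for unitary `V`. [folklore] -/
theorem abs_hess_self_le {V : Site d → Fin d → (Matrix n n ℂ)ˣ} (hV : IsUnitaryCfg V)
    (X : Site d → Fin d → Matrix n n ℂ) (W : Finset (T4AveragingDeficitWall.Plaq d)) :
    |hess V X X W| ≤ 7 * ∑ p ∈ W, bondSq X p := by
  unfold hess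
  rw [Finset.mul_sum]
  refine (Finset.abs_sum_le_sum_abs _ _).trans (Finset.sum_le_sum fun p _ => ?_)
  exact abs_hessPlaqAt_self_le hV X p.1 p.2.1.1 p.2.1.2

/-- Along the segment `V·e^{tX}` (skew `X`) the bound is UNIFORM in `t`: the varied configuration is unitary and the
right-hand side does not see the configuration. [folklore] -/
theorem abs_hess_vary_self_le {V : Site d → Fin d → (Matrix n n ℂ)ˣ} (hV : IsUnitaryCfg V)
    {X : Site d → Fin d → Matrix n n ℂ} (hX : IsSkewDir X) (W : Finset (T4AveragingDeficitWall.Plaq d)) (t : ℝ) :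
    |hess (vary V X t) X X W| ≤ 7 * ∑ p ∈ W, bondSq X p :=
  abs_hess_self_le (vary_isUnitaryCfg hV hX t) X W

/-! ## §2 Second-order Taylor along the unit segment -/

/-- **THE ACTION ALONG THE UNIT SEGMENT, TO SECOND ORDER**: for unitary `V` and skew `X`,
`|A_W(V e^X) − A_W(V) − dAction V X W| ≤ (7/2)·Σ_{p∈W} bondSq X p` — the tree's `taylor_lower` applied to the action and to
its negative with the uniform Hessian bound of §1 (`segment_derivData` supplies both derivative hypotheses). [folklore] -/
theorem abs_fineAction_vary_sub_sub_dAction_le {V : Site d → Fin d → (Matrix n n ℂ)ˣ} (hV : IsUnitaryCfg V)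
    {X : Site d → Fin d → Matrix n n ℂ} (hX : IsSkewDir X) (W : Finset (T4AveragingDeficitWall.Plaq d)) :
    |fineAction (vary V X 1) W - fineAction V W - dAction V X W| ≤ 7 / 2 * ∑ p ∈ W, bondSq X p := by
  obtain ⟨h1, h2⟩ := segment_derivData V X W
  set M : ℝ := 7 * ∑ p ∈ W, bondSq X p with hM
  have hlo : ∀ t ∈ Icc (0 : ℝ) 1, -M ≤ hess (vary V X t) X X W := fun t _ =>
    neg_le_of_abs_le (abs_hess_vary_self_le hV hX W t)
  have hup : ∀ t ∈ Icc (0 : ℝ) 1, -M ≤ -hess (vary V X t) X X W := fun t _ => by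
    have := (abs_hess_vary_self_le hV hX W t)
    have := le_abs_self (hess (vary V X t) X X W)
    linarith
  -- lower Taylor bound for the action
  have lo := taylor_lower h1 h2 hlo
  -- lower Taylor bound for MINUS the action
  have h1' : ∀ t ∈ Icc (0 : ℝ) 1,
      HasDerivAt (fun s : ℝ => -fineAction (vary V X s) W) (-dAction (vary V X t) X W) t := fun t ht => (h1 t ht).neg
  have h2' : ∀ t ∈ Icc (0 : ℝ) 1,
      HasDerivAt (fun s : ℝ => -dAction (vary V X s) X W) (-hess (vary V X t) X X W) t := fun t ht => (h2 t ht).neg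
  have up := taylor_lower h1' h2' hup
  have hv0 : vary V X 0 = V := by
    funext x κ; simp [vary]
  rw [hv0] at lo up
  rw [abs_le]
  constructor <;> linarith

/-! ## §3 THE (D) READ-OUT BRACKET -/

/-- **THE LOCAL ACTION READ-OUT** (row S6-Z2, P3 L12 (D), second bracket): for unitary `V` whose plaquette variables on the
window `W` are within `a` of `1` and a skew direction `X`,
`|A_W(V e^X) − A_W(V)| ≤ a·Σ_{p∈W}‖(d_V X)(p)‖ + (7/2)·Σ_{p∈W} bondSq X p`.
The linear term is `O(radius × curl)` — NOT `O(curl)` — because the first variation at a flat plaquette of a skew insertion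
has zero real trace; the quadratic term is the uniform Hessian bound.  With road P3's local energy rate (T-LOC-P3:
`Σ_{B(x)}‖curl‖² + ‖X‖² ≲ ε²(L⁻¹)^{2k}`, volume-free) and Cauchy–Schwarz on the `O(L⁴)` plaquettes of a unit block this is the
`LocalRate R_D (C_D ε²) (L⁻¹)` face — assembled in Z0, not here. [folklore] -/
theorem abs_fineAction_vary_sub_le {V : Site d → Fin d → (Matrix n n ℂ)ˣ} (hV : IsUnitaryCfg V)
    {X : Site d → Fin d → Matrix n n ℂ} (hX : IsSkewDir X) (W : Finset (T4AveragingDeficitWall.Plaq d)) {a : ℝ}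
    (ha : ∀ p ∈ W, ‖((fhol V p : (Matrix n n ℂ)ˣ) : Matrix n n ℂ) - 1‖ ≤ a) :
    |fineAction (vary V X 1) W - fineAction V W| ≤ a * ∑ p ∈ W, ‖curl V X p‖ + 7 / 2 * ∑ p ∈ W, bondSq X p := by
  have h2 := abs_fineAction_vary_sub_sub_dAction_le hV hX W
  have h1 : |dAction V X W| ≤ a * ∑ p ∈ W, ‖curl V X p‖ := by
    unfold dAction
    rw [abs_neg]
    exact abs_sum_nReTr_curl_fhol_le hV hX W ha
  have e : fineAction (vary V X 1) W - fineAction V W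
      = (fineAction (vary V X 1) W - fineAction V W - dAction V X W) + dAction V X W := by ring
  rw [e]
  exact (abs_add_le _ _).trans (by linarith)

/-- The same under the tree's `SmallField V a` (every plaquette variable of `V` within `a` of `1`). [folklore] -/
theorem abs_fineAction_vary_sub_le_of_smallField {V : Site d → Fin d → (Matrix n n ℂ)ˣ} (hV : IsUnitaryCfg V)
    {X : Site d → Fin d → Matrix n n ℂ} (hX : IsSkewDir X) {a : ℝ} (hVa : SmallField V a)
    (W : Finset (T4AveragingDeficitWall.Plaq d)) :
    |fineAction (vary V X 1) W - fineAction V W| ≤ a * ∑ p ∈ W, ‖curl V X p‖ + 7 / 2 * ∑ p ∈ W, bondSq X p :=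
  abs_fineAction_vary_sub_le hV hX W (fhol_sub_one_le_of_smallField hVa W)

end

end Summit.QuantumFields.BalabanUV.T4Continuum.NE3LocalReadouts
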